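import Summits.CriticalPhenomena.Ising3DConformalLimit.Theorems.MoebiusLimitExists.Negative.RatioRegular

/-!
# `MoebiusLimit` (item stmt-CriticalPhenomena-1344) forces ratio regularity, doubling and isotropy of `⟨σ₀σ_x⟩_{β_c}` on `ℤ³`

Corollaries of `Negative/RatioRegular.lean` (`two_point_ratio_asymptotics`), standing crux
disprover (D-0016); THEOREM-ONLY. For any `O(3)`+scale-covariant (dimension `Δ`) non-degenerate
pointwise limit of the critical correlators on `ℤ³` — in particular for any witness of the crux
`…Theses.EnergyNotSigmaSquared.MoebiusLimit` (= `PerfectScreening.MoebiusLimitExists`):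
* `tendsto_twoPoint_ratio_shift` / `moebiusLimit_implies_ratio_regularity` — RATIO REGULARITY
  `⟨σ₀σ_{x+u}⟩_{β_c}/⟨σ₀σ_x⟩_{β_c} → 1` (`x → ∞`, `u` fixed), an OPEN lattice statement on `ℤ³`;
* `tendsto_twoPoint_ratio_double` / `moebiusLimit_implies_doubling` — DOUBLING
  `⟨σ₀σ_{2x}⟩/⟨σ₀σ_x⟩ → 2^{−2Δ}` with `Δ ∈ [1/2, 3/4]` (the outward Messager–Miracle-Solé
  comparison with its sharp constant, open);
* `twoPoint_isotropy` / `moebiusLimit_implies_isotropy` — asymptotic EUCLIDEAN ISOTROPY: equal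
  Euclidean norms give asymptotically equal two-point functions.
So the crux is at least as strong as each of these open two-point statements; conversely they are
the first lattice tests of any claimed construction of the limit.
-/

noncomputable section

namespace Summit.CriticalPhenomena.Ising3DConformalLimit.MoebiusLimitExistsNegative

open Literature.Probability.LatticeModels Filter Set
open scoped Topology

variable {ρ : ℝ → ℝ} {Δ : ℝ} {S : CorrFamily 3}


/-- `siteVec` is additive. [folklore] -/
theorem siteVec_add (x u : Site 3) : siteVec (x + u) = siteVec x + siteVec u := by
  ext i; simp [siteVec_apply]

/-- `siteVec (2 • x) = 2 • siteVec x`. [folklore] -/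
theorem siteVec_two_smul (x : Site 3) : siteVec ((2:ℤ) • x) = (2:ℝ) • siteVec x := by
  ext i; simp [siteVec_apply]

/-- Large sup norm forces large Euclidean norm of the embedded point. [folklore] -/
theorem norm_le_norm_siteVec (x : Site 3) : ‖x‖ ≤ ‖siteVec x‖ := by
  rw [Site.norm_eq_supNorm]; exact supNorm_le_norm_siteVec x

/-- Sets of lattice points of bounded norm are finite. [folklore] -/
theorem finite_norm_lt (R : ℝ) : {x : Site 3 | ‖x‖ < R}.Finite := by
  refine (box 3 ⌈R⌉₊).finite_toSet.subset fun x hx => ?_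
  rw [Finset.mem_coe, mem_box_iff_supNorm_le]
  rw [Set.mem_setOf_eq, Site.norm_eq_supNorm] at hx
  have : (Site.supNorm x : ℝ) ≤ ⌈R⌉₊ := hx.le.trans (Nat.le_ceil R)
  exact_mod_cast this

/-- **RATIO REGULARITY is forced**: `⟨σ₀σ_{x+u}⟩_{β_c} / ⟨σ₀σ_x⟩_{β_c} → 1` as `x → ∞`, for every
fixed lattice vector `u` — an OPEN lattice statement on `ℤ³` (needed e.g. by the RungOne second
moment of route EnergyNotSigmaSquared), implied by any `O(3)`+scale-covariant non-degenerate
pointwise limit, in particular by the crux. [folklore] -/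
theorem tendsto_twoPoint_ratio_shift (hρ : ∀ δ ∈ Set.Ioc (0:ℝ) 1, 0 < ρ δ)
    (hlim : HasPointwiseScalingLimit (criticalCorr 3) ρ S) (hnd : IsNondegenerateTwoPoint S)
    (hrot : IsRotationInvariant S) (hsc : IsScaleCovariant Δ S) (u : Site 3) :
    Tendsto (fun x : Site 3 => criticalTwoPoint 3 (x + u) / criticalTwoPoint 3 x) cofinite (𝓝 1) := by
  rw [Metric.tendsto_nhds]
  intro ε hε
  -- continuity of `t ↦ t^{-2Δ}` at `1`
  have hcont : ContinuousAt (fun t : ℝ => t ^ (-(2:ℝ) * Δ)) 1 :=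
    Real.continuousAt_rpow_const 1 _ (Or.inl one_ne_zero)
  obtain ⟨η, hη, hηcont⟩ := Metric.continuousAt_iff.1 hcont (ε / 2) (half_pos hε)
  simp only [Real.one_rpow, Real.dist_eq] at hηcont
  set η' : ℝ := min (η / 2) 2⁻¹ with hη'def
  have hη' : 0 < η' := lt_min (half_pos hη) (by norm_num)
  obtain ⟨R, hR⟩ := two_point_ratio_asymptotics hρ hlim hnd hrot hsc (half_pos hε)
  -- beyond `max R (‖û‖/η' + 1)` everything holds
  set R' : ℝ := max R (‖siteVec u‖ / η' + 1) with hR'def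
  rw [Filter.eventually_cofinite]
  refine (finite_norm_lt R').subset fun x hx => ?_
  rw [Set.mem_setOf_eq] at hx ⊢
  by_contra hge
  push Not at hge
  apply hx
  have hxR : R ≤ ‖x‖ := (le_max_left _ _).trans hge
  have hx1 : ‖siteVec u‖ / η' + 1 ≤ ‖siteVec x‖ :=
    ((le_max_right _ _).trans hge).trans (norm_le_norm_siteVec x)
  have hnx : 0 < ‖siteVec x‖ := lt_of_lt_of_le (by positivity) hx1
  have hux : ‖siteVec u‖ ≤ η' * ‖siteVec x‖ := by
    have : ‖siteVec u‖ / η' ≤ ‖siteVec x‖ := by linarith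
    rw [div_le_iff₀ hη'] at this
    linarith
  -- the ratio of norms is within `η'` of `1`
  set t : ℝ := ‖siteVec (x + u)‖ / ‖siteVec x‖ with htdef
  have ht : |t - 1| ≤ η' := by
    rw [htdef, div_sub_one hnx.ne', abs_div, abs_of_pos hnx, div_le_iff₀ hnx]
    have := abs_norm_sub_norm_le (siteVec (x + u)) (siteVec x)
    rw [siteVec_add, add_sub_cancel_left] at this
    rw [siteVec_add]
    exact this.trans hux
  have ht' := abs_sub_le_iff.1 ht
  have hη'2 : η' ≤ 2⁻¹ := min_le_right _ _
  have hy1 : ‖siteVec x‖ / 2 ≤ ‖siteVec (x + u)‖ := by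
    have : 1 - η' ≤ t := by linarith [ht'.2]
    have h2 : (1 - η') * ‖siteVec x‖ ≤ ‖siteVec (x + u)‖ := by
      rw [htdef] at this; rwa [le_div_iff₀ hnx] at this
    nlinarith
  have hy2 : ‖siteVec (x + u)‖ ≤ 2 * ‖siteVec x‖ := by
    have : t ≤ 1 + η' := by linarith [ht'.1]
    have h2 : ‖siteVec (x + u)‖ ≤ (1 + η') * ‖siteVec x‖ := by
      rw [htdef] at this; rwa [div_le_iff₀ hnx] at this
    nlinarith
  have hmain := hR x (x + u) hxR hy1 hy2
  have hpow : |t ^ (-(2:ℝ) * Δ) - 1| < ε / 2 := by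
    apply hηcont
    calc |t - 1| ≤ η' := ht
      _ ≤ η / 2 := min_le_left _ _
      _ < η := half_lt_self hη
  rw [Real.dist_eq]
  calc |criticalTwoPoint 3 (x + u) / criticalTwoPoint 3 x - 1|
      = |(criticalTwoPoint 3 (x + u) / criticalTwoPoint 3 x - t ^ (-(2:ℝ) * Δ)) +
          (t ^ (-(2:ℝ) * Δ) - 1)| := by ring_nf
    _ ≤ |criticalTwoPoint 3 (x + u) / criticalTwoPoint 3 x - t ^ (-(2:ℝ) * Δ)| +
          |t ^ (-(2:ℝ) * Δ) - 1| := abs_add_le _ _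
    _ < ε / 2 + ε / 2 := add_lt_add_of_le_of_lt hmain hpow
    _ = ε := by ring

/-- **DOUBLING is forced**: `⟨σ₀σ_{2x}⟩_{β_c} / ⟨σ₀σ_x⟩_{β_c} → 2^{-2Δ}` as `x → ∞` (the outward
Messager–Miracle-Solé comparison with the sharp constant, open on `ℤ³`). [folklore] -/
theorem tendsto_twoPoint_ratio_double (hρ : ∀ δ ∈ Set.Ioc (0:ℝ) 1, 0 < ρ δ)
    (hlim : HasPointwiseScalingLimit (criticalCorr 3) ρ S) (hnd : IsNondegenerateTwoPoint S)
    (hrot : IsRotationInvariant S) (hsc : IsScaleCovariant Δ S) :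
    Tendsto (fun x : Site 3 => criticalTwoPoint 3 ((2:ℤ) • x) / criticalTwoPoint 3 x) cofinite
      (𝓝 ((2:ℝ) ^ (-(2:ℝ) * Δ))) := by
  rw [Metric.tendsto_nhds]
  intro ε hε
  obtain ⟨R, hR⟩ := two_point_ratio_asymptotics hρ hlim hnd hrot hsc (half_pos hε)
  rw [Filter.eventually_cofinite]
  refine (finite_norm_lt (max R 1)).subset fun x hx => ?_
  rw [Set.mem_setOf_eq] at hx ⊢
  by_contra hge
  push Not at hge
  apply hx
  have hxR : R ≤ ‖x‖ := (le_max_left _ _).trans hge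
  have hnx : 0 < ‖siteVec x‖ :=
    lt_of_lt_of_le (lt_of_lt_of_le one_pos (le_max_right _ _)) (hge.trans (norm_le_norm_siteVec x))
  have hn2 : ‖siteVec ((2:ℤ) • x)‖ = 2 * ‖siteVec x‖ := by
    rw [siteVec_two_smul, norm_smul, Real.norm_eq_abs, abs_of_pos two_pos]
  have hy1 : ‖siteVec x‖ / 2 ≤ ‖siteVec ((2:ℤ) • x)‖ := by rw [hn2]; linarith
  have hy2 : ‖siteVec ((2:ℤ) • x)‖ ≤ 2 * ‖siteVec x‖ := by rw [hn2]
  have h := hR x _ hxR hy1 hy2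
  rw [hn2, mul_div_assoc, div_self hnx.ne', mul_one] at h
  rw [Real.dist_eq]
  linarith

/-- **Asymptotic EUCLIDEAN ISOTROPY is forced**: lattice points with equal Euclidean norms have
asymptotically equal critical two-point functions (the lattice two-point function forgets the
cubic anisotropy at large distances). [folklore] -/
theorem twoPoint_isotropy (hρ : ∀ δ ∈ Set.Ioc (0:ℝ) 1, 0 < ρ δ)
    (hlim : HasPointwiseScalingLimit (criticalCorr 3) ρ S) (hnd : IsNondegenerateTwoPoint S)
    (hrot : IsRotationInvariant S) (hsc : IsScaleCovariant Δ S) {ε : ℝ} (hε : 0 < ε) :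
    ∃ R : ℝ, ∀ x y : Site 3, R ≤ ‖x‖ → ‖siteVec y‖ = ‖siteVec x‖ →
      |criticalTwoPoint 3 y / criticalTwoPoint 3 x - 1| ≤ ε := by
  obtain ⟨R, hR⟩ := two_point_ratio_asymptotics hρ hlim hnd hrot hsc hε
  refine ⟨max R 1, fun x y hx hyx => ?_⟩
  have hxR : R ≤ ‖x‖ := (le_max_left _ _).trans hx
  have hnx : 0 < ‖siteVec x‖ :=
    lt_of_lt_of_le (lt_of_lt_of_le one_pos (le_max_right _ _)) (hx.trans (norm_le_norm_siteVec x))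
  have h := hR x y hxR (by rw [hyx]; linarith) (by rw [hyx]; linarith)
  rwa [hyx, div_self hnx.ne', Real.one_rpow] at h

/-- **The crux implies ratio regularity of `⟨σ₀σ_x⟩_{β_c}` on `ℤ³`.** [folklore] -/
theorem moebiusLimit_implies_ratio_regularity
    (h : Summit.CriticalPhenomena.Ising3DConformalLimit.Theses.EnergyNotSigmaSquared.MoebiusLimit)
    (u : Site 3) :
    Tendsto (fun x : Site 3 => criticalTwoPoint 3 (x + u) / criticalTwoPoint 3 x) cofinite (𝓝 1) := by
  obtain ⟨ρ, Δ, S, hρ, -, hlim, hnd, hM⟩ := h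
  exact tendsto_twoPoint_ratio_shift hρ hlim hnd hM.isEuclideanInvariant.2 hM.isScaleCovariant u

/-- **The crux implies two-point doubling with exponent in `[1/2, 3/4]`.** [folklore] -/
theorem moebiusLimit_implies_doubling
    (h : Summit.CriticalPhenomena.Ising3DConformalLimit.Theses.EnergyNotSigmaSquared.MoebiusLimit) :
    ∃ Δ : ℝ, Δ ∈ Set.Icc (1 / 2 : ℝ) (3 / 4) ∧
      Tendsto (fun x : Site 3 => criticalTwoPoint 3 ((2:ℤ) • x) / criticalTwoPoint 3 x) cofinite
        (𝓝 ((2:ℝ) ^ (-(2:ℝ) * Δ))) := by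
  obtain ⟨ρ, Δ, S, hρ, -, hlim, hnd, hM⟩ := h
  exact ⟨Δ, delta_mem_Icc_of_covariantLimit hρ hlim hnd hM.isEuclideanInvariant.2 hM.isScaleCovariant,
    tendsto_twoPoint_ratio_double hρ hlim hnd hM.isEuclideanInvariant.2 hM.isScaleCovariant⟩

/-- **The crux implies asymptotic Euclidean isotropy of `⟨σ₀σ_x⟩_{β_c}` on `ℤ³`.** [folklore] -/
theorem moebiusLimit_implies_isotropy
    (h : Summit.CriticalPhenomena.Ising3DConformalLimit.Theses.EnergyNotSigmaSquared.MoebiusLimit)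
    {ε : ℝ} (hε : 0 < ε) :
    ∃ R : ℝ, ∀ x y : Site 3, R ≤ ‖x‖ → ‖siteVec y‖ = ‖siteVec x‖ →
      |criticalTwoPoint 3 y / criticalTwoPoint 3 x - 1| ≤ ε := by
  obtain ⟨ρ, Δ, S, hρ, -, hlim, hnd, hM⟩ := h
  exact twoPoint_isotropy hρ hlim hnd hM.isEuclideanInvariant.2 hM.isScaleCovariant hε

end Summit.CriticalPhenomena.Ising3DConformalLimit.MoebiusLimitExistsNegative

end
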